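import Summits.Ventures.CertifiedArithmetic.LowPrec.SRLimitedBitsMSE
import HarnessLib

/-!
# Stochastic rounding in low-precision formats LXI — the GENERAL mean-square error law of recursive
# summation under limited-randomness SR: `RMS(ŝₙ − sₙ) ≤ √n·G/2 + n·ε·G` on every window, across zero
# and across binade boundaries (martingale + predictable drift on a two-register outcome tree)

HONEST FRAMING: certified error envelopes and provably optimal rounding/accumulation schemes for
low-precision formats under stated cost models; every table by two implementations; no hardware or
vendor claims.

Setting as file LX (`LowPrec/SRLimitedBitsMSE`): each addition is rounded into the finite value set `F`
AWAY from zero with probability `q(θ)`, `θ` the exact-SR away-probability, `q : [0,1] → [0,1]`,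
`|q(θ) − θ| ≤ ε` (P3109 StochasticA: `ε = 2^{-N}`; B, C: `2^{-(N+1)}`; `SR_ε`: `ε`; exact SR: `0`);
`ŝ₀ = s`, `ŝₖ₊₁ = round(ŝₖ + xₖ)`, `sₙ = s + ∑ xₖ`, `e = ŝₙ − sₙ`.  File LX proved the Pythagorean law
`E e² ≤ n·g²/4 + (nεg)²` on equally spaced ONE-SIGNED windows and showed by a kernel-checked instance
(`FP4.e2m1_mse_cross_zero`, `5/32 > 9/64`) that it FAILS across zero.  Here, with NO window or sign
hypothesis — only no saturation and candidate gaps `≤ G` on every branch: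
1. `accExpD` — the outcome tree carrying a second register, the accumulated CONDITIONAL BIAS (predictable
   drift) `D = ∑ₖ βₖ`, `βₖ = E[ŝₖ₊₁ | ŝₖ] − (ŝₖ + xₖ)`; `accExpD_eq_accExpQ`: functionals of the final value
   alone have the file-XIX expectation.
2. `accExpD_mart_mean`, `accExpD_mart_sq_le`: the martingale part `M = e − D` has `E M = 0` and
   `E M² ≤ n·G²/4` (sum of conditional two-point variances `π(1−π)gap² ≤ G²/4`); `accExpD_mono_reach`:
   along every branch `|D| ≤ n·ε·G`.
3. `accExpQ_sq_le_general`: for every `λ > 0`, `E e² ≤ (1+λ)·n·G²/4 + (1+λ⁻¹)·(nεG)²` (pathwise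
   `(M+D)² ≤ (1+λ)M² + (1+λ⁻¹)D²`); over `ℝ` (`accExpQ_sq_le_rms`): `E e² ≤ (√n·G/2 + n·ε·G)²`, i.e. the
   RMS TRIANGLE LAW `RMS(e) ≤ √n·G/2 + nεG`; instances `srEps_acc_sq_le_general`,
   `stochasticA/B/C_acc_sq_le_general`; `accExpQ_sq_le_of_exact`: `ε = 0` gives `E e² ≤ n·G²/4` on any
   window (the drift register never moves).  The two budgets are equal iff `n·ε² = 1/4` — the same crossover
   as file LX (`LimitedBits.bias_sq_le_var_iff`).
So: in general the noise and bias budgets add in RMS (triangle), on equally spaced one-signed windows in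
mean square (Pythagoras, file LX), and some cross term is unavoidable across zero (file LX witness:
`E e² = 5/32` against Pythagoras `9/64` and triangle `(√2/4 + 1/8)² ≈ 0.229`).  Sharp constants in the
cross term and binade crossings under one sign are NOT claimed (sr-seat certificates gen12/mse:
no violation of the Pythagorean law with `G` in 145 292 one-signed two-spacing instances).
Prior art: [ElararEtAl2025, Thm. 3–4] bound the error of `SR_{p,r}` summation by a `√n·u_p` martingale
term (probability `1 − λ`) plus `n·u_{p+r}`, to first order; the present statements are exact second-moment
inequalities for every admissible `q` on any finite value set, saturation excluded by hypothesis only.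
-/


namespace Summit.Ventures.CertifiedArithmetic.LowPrec.SR

open Literature.ComputerArithmetic.ConnollyHighamMary2021
open Finset

variable {K : Type*} [Field K] [LinearOrder K] [IsStrictOrderedRing K]

namespace LimitedBits

/-- Conditional bias of one perturbed step at pre-rounding value `c`: `β(c) = E[round(c)] − c̄`. -/
def biasQ (F : Finset K) (q : K → K) (c : K) : K := stepQ F q c (fun t => t) - clamp F c

/-- **Two-register outcome tree**: `E f(ŝₙ, D₀ + ∑ₖ βₖ)` — the test function sees the final value and the
accumulated conditional bias (predictable drift) along the branch. -/
def accExpD (F : Finset K) (q : K → K) : (ℕ → K) → ℕ → (K → K → K) → K → K → K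
  | _, 0, f, s, D => f s D
  | x, n + 1, f, s, D => stepQ F q (s + x 0)
      (fun t => accExpD F q (fun i => x (i + 1)) n f t (D + biasQ F q (s + x 0)))

omit [IsStrictOrderedRing K] in
/-- Functionals of the final value alone: `accExpD` agrees with `accExpQ` (file XIX). -/
theorem accExpD_eq_accExpQ (F : Finset K) (q : K → K) (g : K → K) :
    ∀ (x : ℕ → K) (n : ℕ) (s D : K), accExpD F q x n (fun t _ => g t) s D = accExpQ F q x n g s := by
  intro x n
  induction n generalizing x with
  | zero => intro s D; rfl
  | succ n ih =>
    intro s D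
    show stepQ F q (s + x 0) (fun t => accExpD F q (fun i => x (i + 1)) n (fun t _ => g t) t _)
      = stepQ F q (s + x 0) (accExpQ F q (fun i => x (i + 1)) n g)
    congr 1; funext t; exact ih _ t _

omit [IsStrictOrderedRing K] in
/-- Linearity of the two-register expectation. -/
theorem accExpD_lin (F : Finset K) (q : K → K) :
    ∀ (x : ℕ → K) (n : ℕ) (a b : K) (f h : K → K → K) (s D : K),
      accExpD F q x n (fun t D => a * f t D + b * h t D) s D
        = a * accExpD F q x n f s D + b * accExpD F q x n h s D := by
  intro x n
  induction n generalizing x with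
  | zero => intro a b f h s D; rfl
  | succ n ih =>
    intro a b f h s D
    show stepQ F q (s + x 0) (fun t => accExpD F q (fun i => x (i + 1)) n (fun t D => a * f t D + b * h t D)
        t (D + biasQ F q (s + x 0)))
      = a * stepQ F q (s + x 0) (fun t => accExpD F q (fun i => x (i + 1)) n f t (D + biasQ F q (s + x 0)))
        + b * stepQ F q (s + x 0) (fun t => accExpD F q (fun i => x (i + 1)) n h t (D + biasQ F q (s + x 0)))
    have : (fun t => accExpD F q (fun i => x (i + 1)) n (fun t D => a * f t D + b * h t D) t
        (D + biasQ F q (s + x 0))) = fun t =>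
        a * accExpD F q (fun i => x (i + 1)) n f t (D + biasQ F q (s + x 0))
          + b * accExpD F q (fun i => x (i + 1)) n h t (D + biasQ F q (s + x 0)) :=
      funext fun t => ih _ a b f h t _
    rw [this]; unfold stepQ; ring

omit [IsStrictOrderedRing K] in
/-- `E[1] = 1` on the two-register tree. -/
theorem accExpD_one (F : Finset K) (q : K → K) (x : ℕ → K) (n : ℕ) (s D : K) :
    accExpD F q x n (fun _ _ => (1 : K)) s D = 1 := by
  rw [accExpD_eq_accExpQ, accExpQ_one]

/-- **Monotonicity on reachable branches**: along every branch the drift register moves by at most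
`n·ε·G` (`|βₖ| ≤ ε·gapₖ ≤ ε·G`), so a pointwise inequality `f ≤ h` on `|D' − D| ≤ nεG` integrates. -/
theorem accExpD_mono_reach (F : Finset K) {q : K → K} {ε G : K}
    (hq01 : ∀ η, 0 ≤ η → η ≤ 1 → 0 ≤ q η ∧ q η ≤ 1) (hq : ∀ η, 0 ≤ η → η ≤ 1 → |q η - η| ≤ ε) :
    ∀ (x : ℕ → K) (n : ℕ) (f h : K → K → K) (s D : K), NoSat F x n s → GapLE F G x n s →
      (∀ t D', |D' - D| ≤ n * (ε * G) → f t D' ≤ h t D') →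
        accExpD F q x n f s D ≤ accExpD F q x n h s D := by
  have hε : 0 ≤ ε := (abs_nonneg _).trans (hq 0 le_rfl zero_le_one)
  intro x n
  induction n generalizing x with
  | zero =>
    intro f h s D _ _ hfh
    exact hfh s D (by simp)
  | succ n ih =>
    rintro f h s D ⟨hin, hnu, hnd⟩ ⟨hg, hgu, hgd⟩ hfh
    have hg' : up F (s + x 0) - dn F (s + x 0) ≤ G := hg
    have hβ : |biasQ F q (s + x 0)| ≤ ε * G :=
      (abs_stepQ_id_sub_le F hq (s + x 0)).trans (mul_le_mul_of_nonneg_left hg' hε)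
    have hreach : ∀ t D', |D' - (D + biasQ F q (s + x 0))| ≤ n * (ε * G) → f t D' ≤ h t D' := by
      intro t D' hD'
      refine hfh t D' ?_
      have htri : |D' - D| ≤ |D' - (D + biasQ F q (s + x 0))| + |biasQ F q (s + x 0)| := by
        have := abs_add_le (D' - (D + biasQ F q (s + x 0))) (biasQ F q (s + x 0))
        rwa [show D' - (D + biasQ F q (s + x 0)) + biasQ F q (s + x 0) = D' - D by ring] at this
      have : (↑(n + 1) : K) * (ε * G) = n * (ε * G) + ε * G := by push_cast; ring
      linarith
    have hu := ih (fun i => x (i + 1)) f h (up F (s + x 0)) (D + biasQ F q (s + x 0)) hnu hgu hreach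
    have hd := ih (fun i => x (i + 1)) f h (dn F (s + x 0)) (D + biasQ F q (s + x 0)) hnd hgd hreach
    obtain ⟨hp0, hp1⟩ := pUpQ_mem F hq01 (s + x 0)
    show stepQ F q (s + x 0) _ ≤ stepQ F q (s + x 0) _
    unfold stepQ
    have a1 := mul_le_mul_of_nonneg_left hu hp0
    have a2 := mul_le_mul_of_nonneg_left hd (sub_nonneg.mpr hp1)
    linarith

omit [IsStrictOrderedRing K] in
/-- **The martingale part has mean zero**: `E[ŝₙ − D] = sₙ − D₀` (no saturation). -/
theorem accExpD_mart_mean (F : Finset K) (q : K → K) :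
    ∀ (x : ℕ → K) (n : ℕ) (s D : K), NoSat F x n s →
      accExpD F q x n (fun t D' => t - D') s D = (s + ∑ i ∈ range n, x i) - D := by
  intro x n
  induction n generalizing x with
  | zero => intro s D _; simp [accExpD]
  | succ n ih =>
    rintro s D ⟨hin, hnu, hnd⟩
    have hsum : s + ∑ i ∈ range (n + 1), x i = (s + x 0) + ∑ i ∈ range n, x (i + 1) := by
      rw [Finset.sum_range_succ']; ring
    rw [hsum]
    show stepQ F q (s + x 0) (fun t => accExpD F q (fun i => x (i + 1)) n (fun t D' => t - D') t
      (D + biasQ F q (s + x 0))) = _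
    simp only [stepQ]
    rw [ih _ _ _ hnu, ih _ _ _ hnd]
    unfold biasQ; simp only [stepQ]; rw [clamp_eq_self hin]; ring

omit [IsStrictOrderedRing K] in
/-- Re-centring the squared martingale functional (linearity). -/
theorem accExpD_sq_shift (F : Finset K) (q : K → K) (x : ℕ → K) (n : ℕ) (t D₁ a a' : K) :
    accExpD F q x n (fun y D' => (y - D' - a) ^ 2) t D₁
      = accExpD F q x n (fun y D' => (y - D' - a') ^ 2) t D₁
        - 2 * (a - a') * (accExpD F q x n (fun y D' => y - D') t D₁ - a') + (a - a') ^ 2 := by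
  have h1 : (fun y D' : K => (y - D' - a) ^ 2) = fun y D' =>
      1 * (y - D' - a') ^ 2 + 1 * ((-2 * (a - a')) * (y - D') + ((a - a') ^ 2 + 2 * (a - a') * a') * 1) := by
    funext y D'; ring
  rw [h1, accExpD_lin, accExpD_lin, accExpD_one]; ring

/-- **The martingale part has second moment `≤ n·G²/4`**: `E(ŝₙ − sₙ − (D − D₀))² ≤ n·G²/4` — the sum of
the conditional two-point variances `π(1−π)·gap² ≤ G²/4`, orthogonal increments (no saturation, gaps `≤ G`,
`q` into `[0,1]`). -/
theorem accExpD_mart_sq_le (F : Finset K) {q : K → K} {G : K}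
    (hq01 : ∀ η, 0 ≤ η → η ≤ 1 → 0 ≤ q η ∧ q η ≤ 1) :
    ∀ (x : ℕ → K) (n : ℕ) (s D a : K), NoSat F x n s → GapLE F G x n s →
      a = (s + ∑ i ∈ range n, x i) - D →
        accExpD F q x n (fun y D' => (y - D' - a) ^ 2) s D ≤ n * (G ^ 2 / 4) := by
  intro x n
  induction n generalizing x with
  | zero => intro s D a _ _ ha; simp [accExpD, ha]
  | succ n ih =>
    rintro s D a ⟨hin, hnu, hnd⟩ ⟨hg, hgu, hgd⟩ ha
    have hg' : up F (s + x 0) - dn F (s + x 0) ≤ G := hg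
    have hg0 : 0 ≤ up F (s + x 0) - dn F (s + x 0) := sub_nonneg.mpr (dn_le_up F _)
    rw [Finset.sum_range_succ'] at ha
    show stepQ F q (s + x 0) (fun t => accExpD F q (fun i => x (i + 1)) n
      (fun y D' => (y - D' - a) ^ 2) t (D + biasQ F q (s + x 0))) ≤ _
    simp only [stepQ]
    set c := s + x 0 with hc
    set β := biasQ F q c with hβ
    set S' : K := ∑ i ∈ range n, x (i + 1) with hS'
    have hβ' : β = pUpQ F q c * up F c + (1 - pUpQ F q c) * dn F c - c := by
      rw [hβ]; unfold biasQ; simp only [stepQ]; rw [clamp_eq_self hin]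
    rw [accExpD_sq_shift F q _ n (up F c) (D + β) a (up F c + S' - (D + β)),
      accExpD_sq_shift F q _ n (dn F c) (D + β) a (dn F c + S' - (D + β)),
      accExpD_mart_mean F q _ n (up F c) (D + β) hnu, accExpD_mart_mean F q _ n (dn F c) (D + β) hnd]
    have hVu := ih (fun i => x (i + 1)) (up F c) (D + β) (up F c + S' - (D + β)) hnu hgu rfl
    have hVd := ih (fun i => x (i + 1)) (dn F c) (D + β) (dn F c + S' - (D + β)) hnd hgd rfl
    have ha' : a = c + S' - D := by rw [ha, hc, hS']; ring
    obtain ⟨hp0, hp1⟩ := pUpQ_mem F hq01 c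
    have hvar : pUpQ F q c * (a - (up F c + S' - (D + β))) ^ 2
        + (1 - pUpQ F q c) * (a - (dn F c + S' - (D + β))) ^ 2
        = pUpQ F q c * (1 - pUpQ F q c) * (up F c - dn F c) ^ 2 := by
      rw [ha', hβ']; ring
    have h14 : pUpQ F q c * (1 - pUpQ F q c) ≤ 1 / 4 := by nlinarith [sq_nonneg (2 * pUpQ F q c - 1)]
    have hG2 : (up F c - dn F c) ^ 2 ≤ G ^ 2 := pow_le_pow_left₀ hg0 hg' 2
    have hvar' : pUpQ F q c * (1 - pUpQ F q c) * (up F c - dn F c) ^ 2 ≤ 1 / 4 * G ^ 2 :=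
      mul_le_mul h14 hG2 (sq_nonneg _) (by norm_num)
    set π := pUpQ F q c
    set Vu := accExpD F q (fun i => x (i + 1)) n (fun y D' => (y - D' - (up F c + S' - (D + β))) ^ 2)
      (up F c) (D + β)
    set Vd := accExpD F q (fun i => x (i + 1)) n (fun y D' => (y - D' - (dn F c + S' - (D + β))) ^ 2)
      (dn F c) (D + β)
    clear_value π Vu Vd
    have a1 := mul_le_mul_of_nonneg_left hVu hp0
    have a2 := mul_le_mul_of_nonneg_left hVd (sub_nonneg.mpr hp1)
    have hexp : π * (Vu - 2 * (a - (up F c + S' - (D + β))) * (up F c + S' - (D + β) - (up F c + S' - (D + β)))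
          + (a - (up F c + S' - (D + β))) ^ 2)
        + (1 - π) * (Vd - 2 * (a - (dn F c + S' - (D + β))) * (dn F c + S' - (D + β) - (dn F c + S' - (D + β)))
          + (a - (dn F c + S' - (D + β))) ^ 2)
        = (π * Vu + (1 - π) * Vd) + (π * (a - (up F c + S' - (D + β))) ^ 2
          + (1 - π) * (a - (dn F c + S' - (D + β))) ^ 2) := by ring
    rw [hexp, hvar]
    have hfin : (n : K) * (G ^ 2 / 4) + 1 / 4 * G ^ 2 = (↑(n + 1) : K) * (G ^ 2 / 4) := by push_cast; ring
    linarith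

/-- Pathwise Young/AM–GM: `(M + D)² ≤ (1 + r)·M² + (1 + r⁻¹)·D²` for `r > 0`. -/
theorem sq_add_le_young {r : K} (hr : 0 < r) (M D : K) :
    (M + D) ^ 2 ≤ (1 + r) * M ^ 2 + (1 + r⁻¹) * D ^ 2 := by
  have key : (1 + r) * M ^ 2 + (1 + r⁻¹) * D ^ 2 - (M + D) ^ 2 = r⁻¹ * (r * M - D) ^ 2 := by
    field_simp; ring
  nlinarith [mul_nonneg (inv_pos.mpr hr).le (sq_nonneg (r * M - D))]

/-- **General mean-square error law** (any window, across zero, across binade boundaries): with no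
saturating branch and candidate gaps `≤ G` on every branch, for every `r > 0`,
`E(ŝₙ − sₙ)² ≤ (1 + r)·n·G²/4 + (1 + r⁻¹)·(n·ε·G)²` — martingale budget and drift budget combined by
the pathwise inequality `(M + D)² ≤ (1+r)M² + (1+r⁻¹)D²`; over `ℝ` this is `RMS ≤ √n·G/2 + nεG`
(`accExpQ_sq_le_rms`). -/
theorem accExpQ_sq_le_general (F : Finset K) {q : K → K} {ε G : K}
    (hq01 : ∀ η, 0 ≤ η → η ≤ 1 → 0 ≤ q η ∧ q η ≤ 1) (hq : ∀ η, 0 ≤ η → η ≤ 1 → |q η - η| ≤ ε)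
    (x : ℕ → K) (n : ℕ) (s : K) (hns : NoSat F x n s) (hgap : GapLE F G x n s) {r : K} (hr : 0 < r) :
    accExpQ F q x n (fun t => (t - (s + ∑ i ∈ range n, x i)) ^ 2) s
      ≤ (1 + r) * (n * (G ^ 2 / 4)) + (1 + r⁻¹) * (n * (ε * G)) ^ 2 := by
  set S := s + ∑ i ∈ range n, x i with hS
  rw [← accExpD_eq_accExpQ F q (fun t => (t - S) ^ 2) x n s 0]
  have hpt : ∀ t D', |D' - 0| ≤ n * (ε * G) →
      (fun t D' => (t - S) ^ 2) t D'
        ≤ (fun t D' => (1 + r) * (t - D' - (S - 0)) ^ 2 + ((1 + r⁻¹) * (n * (ε * G)) ^ 2) * 1) t D' := by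
    intro t D' hD
    rw [sub_zero] at hD
    have hD2 : D' ^ 2 ≤ (n * (ε * G)) ^ 2 := by
      have := abs_le.mp hD
      nlinarith [this.1, this.2, abs_nonneg D', hD]
    have hy := sq_add_le_young hr (t - D' - (S - 0)) D'
    have h1r : 0 ≤ 1 + r⁻¹ := by positivity
    show (t - S) ^ 2 ≤ (1 + r) * (t - D' - (S - 0)) ^ 2 + ((1 + r⁻¹) * (n * (ε * G)) ^ 2) * 1
    rw [show t - S = (t - D' - (S - 0)) + D' by ring]
    nlinarith [mul_le_mul_of_nonneg_left hD2 h1r]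
  refine (accExpD_mono_reach F hq01 hq x n _ _ s 0 hns hgap hpt).trans ?_
  rw [accExpD_lin, accExpD_one]
  have hV := accExpD_mart_sq_le F hq01 x n s 0 (S - 0) hns hgap (by rw [hS])
  have h1r : 0 ≤ 1 + r := by positivity
  nlinarith [mul_le_mul_of_nonneg_left hV h1r]

/-- **Exact SR as the degenerate case** (`ε = 0`, any window): the drift register never moves, so
`E(ŝₙ − sₙ)² ≤ n·G²/4` with no cross term and no infimum over `r`. -/
theorem accExpQ_sq_le_of_exact (F : Finset K) {q : K → K} {G : K}
    (hq01 : ∀ η, 0 ≤ η → η ≤ 1 → 0 ≤ q η ∧ q η ≤ 1) (hq : ∀ η, 0 ≤ η → η ≤ 1 → |q η - η| ≤ 0)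
    (x : ℕ → K) (n : ℕ) (s : K) (hns : NoSat F x n s) (hgap : GapLE F G x n s) :
    accExpQ F q x n (fun t => (t - (s + ∑ i ∈ range n, x i)) ^ 2) s ≤ n * (G ^ 2 / 4) := by
  set S := s + ∑ i ∈ range n, x i with hS
  rw [← accExpD_eq_accExpQ F q (fun t => (t - S) ^ 2) x n s 0]
  have hpt : ∀ t D', |D' - 0| ≤ n * (0 * G) →
      (fun t D' => (t - S) ^ 2) t D' ≤ (fun t D' => (t - D' - (S - 0)) ^ 2) t D' := by
    intro t D' hD
    have hD0 : D' = 0 := by simpa using hD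
    show (t - S) ^ 2 ≤ (t - D' - (S - 0)) ^ 2
    rw [hD0]; simp
  exact (accExpD_mono_reach F hq01 hq x n _ _ s 0 hns hgap hpt).trans
    (accExpD_mart_sq_le F hq01 x n s 0 (S - 0) hns hgap (by rw [hS]))

end LimitedBits

/-! ### Instances: `SR_ε`, P3109 StochasticA/B/C; the RMS form over `ℝ` -/

/-- `SR_ε` of [XiaEtAl2022] (`q = qAway ε`): `E(ŝₙ − sₙ)² ≤ (1+r)·n·G²/4 + (1+r⁻¹)·(nεG)²`, any window. -/
theorem srEps_acc_sq_le_general (F : Finset K) {ε G : K} (hε : 0 ≤ ε) (x : ℕ → K) (n : ℕ) (s : K)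
    (hns : NoSat F x n s) (hgap : GapLE F G x n s) {r : K} (hr : 0 < r) :
    LimitedBits.accExpQ F (qAway ε) x n (fun t => (t - (s + ∑ i ∈ range n, x i)) ^ 2) s
      ≤ (1 + r) * (n * (G ^ 2 / 4)) + (1 + r⁻¹) * (n * (ε * G)) ^ 2 :=
  LimitedBits.accExpQ_sq_le_general F (qAway_mem hε) (qAway_dev hε) x n s hns hgap hr

section P3109
variable [FloorRing K]

/-- **P3109 StochasticA, `N` bits**, any window: `E(ŝₙ − sₙ)² ≤ (1+r)·n·G²/4 + (1+r⁻¹)·(n·2^{-N}·G)²`. -/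
theorem stochasticA_acc_sq_le_general (F : Finset K) (N : ℕ) {G : K} (x : ℕ → K) (n : ℕ) (s : K)
    (hns : NoSat F x n s) (hgap : GapLE F G x n s) {r : K} (hr : 0 < r) :
    LimitedBits.accExpQ F (LimitedBits.probAwayA N) x n (fun t => (t - (s + ∑ i ∈ range n, x i)) ^ 2) s
      ≤ (1 + r) * (n * (G ^ 2 / 4)) + (1 + r⁻¹) * (n * (1 / 2 ^ N * G)) ^ 2 :=
  LimitedBits.accExpQ_sq_le_general F (LimitedBits.probAwayA_mem N)
    (fun η _ _ => LimitedBits.abs_probAwayA_sub_le N η) x n s hns hgap hr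

/-- **P3109 StochasticB, `N` bits**, any window: drift budget `n·2^{-(N+1)}·G`. -/
theorem stochasticB_acc_sq_le_general (F : Finset K) (N : ℕ) {G : K} (x : ℕ → K) (n : ℕ) (s : K)
    (hns : NoSat F x n s) (hgap : GapLE F G x n s) {r : K} (hr : 0 < r) :
    LimitedBits.accExpQ F (LimitedBits.probAwayB N) x n (fun t => (t - (s + ∑ i ∈ range n, x i)) ^ 2) s
      ≤ (1 + r) * (n * (G ^ 2 / 4)) + (1 + r⁻¹) * (n * (1 / 2 ^ (N + 1) * G)) ^ 2 :=
  LimitedBits.accExpQ_sq_le_general F (LimitedBits.probAwayB_mem N)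
    (fun η _ _ => LimitedBits.abs_probAwayB_sub_le N η) x n s hns hgap hr

/-- **P3109 StochasticC, `N` bits**, any window: drift budget `n·2^{-(N+1)}·G`. -/
theorem stochasticC_acc_sq_le_general (F : Finset K) (N : ℕ) {G : K} (x : ℕ → K) (n : ℕ) (s : K)
    (hns : NoSat F x n s) (hgap : GapLE F G x n s) {r : K} (hr : 0 < r) :
    LimitedBits.accExpQ F (LimitedBits.probAwayC N) x n (fun t => (t - (s + ∑ i ∈ range n, x i)) ^ 2) s
      ≤ (1 + r) * (n * (G ^ 2 / 4)) + (1 + r⁻¹) * (n * (1 / 2 ^ (N + 1) * G)) ^ 2 :=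
  LimitedBits.accExpQ_sq_le_general F (LimitedBits.probAwayC_mem N)
    (fun η _ _ => LimitedBits.abs_probAwayC_sub_le N η) x n s hns hgap hr

end P3109

/-- **RMS triangle law** over `ℝ`: `E(ŝₙ − sₙ)² ≤ (√n·G/2 + n·ε·G)²`, i.e. `RMS(ŝₙ − sₙ) ≤ √n·G/2 + nεG`
(noise budget plus drift budget), for every admissible `q`, any window and sign pattern. -/
theorem LimitedBits.accExpQ_sq_le_rms (F : Finset ℝ) {q : ℝ → ℝ} {ε G : ℝ}
    (hq01 : ∀ η, 0 ≤ η → η ≤ 1 → 0 ≤ q η ∧ q η ≤ 1) (hq : ∀ η, 0 ≤ η → η ≤ 1 → |q η - η| ≤ ε)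
    (hG : 0 ≤ G) (x : ℕ → ℝ) (n : ℕ) (s : ℝ) (hns : NoSat F x n s) (hgap : GapLE F G x n s) :
    LimitedBits.accExpQ F q x n (fun t => (t - (s + ∑ i ∈ range n, x i)) ^ 2) s
      ≤ (Real.sqrt n * G / 2 + n * (ε * G)) ^ 2 := by
  have hε : 0 ≤ ε := (abs_nonneg _).trans (hq 0 le_rfl zero_le_one)
  have hgen := fun r (hr : 0 < r) => LimitedBits.accExpQ_sq_le_general F hq01 hq x n s hns hgap hr
  set E := LimitedBits.accExpQ F q x n (fun t => (t - (s + ∑ i ∈ range n, x i)) ^ 2) s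
  set A := Real.sqrt n * G / 2 with hA
  set B := (n : ℝ) * (ε * G) with hB
  have hA2 : A ^ 2 = n * (G ^ 2 / 4) := by
    rw [hA, div_pow, mul_pow, Real.sq_sqrt (Nat.cast_nonneg n)]; ring
  have hA0 : 0 ≤ A := by rw [hA]; positivity
  have hB0 : 0 ≤ B := by rw [hB]; positivity
  simp only [← hA2] at hgen
  rcases hB0.eq_or_lt with hB00 | hBpos
  · -- no drift budget: `E ≤ (1+r)A²` for every `r > 0`
    rw [← hB00] at hgen ⊢
    simp only [ne_eq, OfNat.ofNat_ne_zero, not_false_eq_true, zero_pow, mul_zero, add_zero] at hgen ⊢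
    refine le_of_forall_pos_le_add fun δ hδ => ?_
    rcases (sq_nonneg A).eq_or_lt with hA00 | hApos
    · have := hgen 1 one_pos; rw [← hA00] at this ⊢; linarith
    · have := hgen (δ / A ^ 2) (by positivity)
      have hA2ne : A ^ 2 ≠ 0 := hApos.ne'
      calc E ≤ (1 + δ / A ^ 2) * A ^ 2 := this
        _ = A ^ 2 + δ := by rw [add_mul, one_mul, div_mul_cancel₀ δ hA2ne]
  · rcases hA0.eq_or_lt with hA00 | hApos
    · -- `A = 0`: then `n = 0` or `G = 0`; the latter contradicts `B > 0`
      have hn0 : (n : ℝ) * (G ^ 2 / 4) = 0 := by rw [← hA2, ← hA00]; ring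
      rcases mul_eq_zero.mp hn0 with hn | hG0
      · have : n = 0 := by exact_mod_cast hn
        subst this
        simp [E, LimitedBits.accExpQ]
        positivity
      · exfalso; have : G = 0 := by nlinarith [sq_nonneg G]
        rw [hB, this] at hBpos; simp at hBpos
    · have := hgen (B / A) (by positivity)
      calc E ≤ (1 + B / A) * A ^ 2 + (1 + (B / A)⁻¹) * B ^ 2 := this
        _ = (A + B) ^ 2 := by field_simp; ring

end Summit.Ventures.CertifiedArithmetic.LowPrec.SR
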